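import Mathlib
import Literature.Analysis.Calculus.ClosedSubgroupTubularMaps
import HarnessLib

/-!
# The invariant tube of a compact linear group (towards Haar measure as a Lebesgue push-forward)

Let `𝔸` be a finite-dimensional real Banach algebra and `ρ : K →* 𝔸` a continuous injective
multiplicative map from a compact group `K` (so `H = ρ(K)` is a compact subgroup of `𝔸ˣ`, closed in
`𝔸`, and `ρ : K ≃ H` is a homeomorphism). Everything here is PROVED; no definitions, no named
facts. From the tubular chart of `H` (`Analysis/Calculus/ClosedSubgroupTubularMaps.lean`) we
build (`exists_invariantTube`):

* an open tube `T ⊆ 𝔸` and a compact `Ω ⊆ T` with `1 ∈ interior Ω`, both invariant under left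
  multiplication by `H`, `Ω = {M ∈ T : 0 ≤ g M}` for a function `g` real-analytic on `T`
  (`g(M) = ρ₀² - Σᵢ eᵢ(a(M))²`, `a` the normal-part projection, `eᵢ` Euclidean coordinates — so
  `Ω` is a compact semianalytic set in the sense of the asymptotic theory of Laplace integrals);
* the group-part projection `q`, real-analytic on `T`, `q(1) = 1`, `q(T) ⊆ H`, `q(hM) = h q(M)`,
  and its lift `qK : 𝔸 → K`, `ρ (qK M) = q M` on `T`, continuous on `T`, `qK(ρ(k) M) = k · qK(M)`.

The sequel `HaarTubePushforwardMeasure.lean` shows that the push-forward of Lebesgue measure on `Ω`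
under `qK` is a (non-zero, finite) left-invariant measure on `K`, hence a constant multiple of Haar
measure — a chart-free substitute for "Haar measure has an analytic density in exponential
coordinates" when Haar integrals over compact linear groups are to be rewritten as Euclidean
integrals (Laplace asymptotics of lattice gauge theory,
`MathematicalPhysics/QuantumFieldTheory/WilsonPartitionRegularVariationProofs.lean`).

## References

* B. C. Hall, *Lie Groups, Lie Algebras, and Representations*, GTM 222, 2nd ed. (2015), Thm. 3.42,
  Cor. 3.45 (closed linear groups are embedded submanifolds). [Hall2015]
-/

noncomputable section

open NormedSpace Filter Topology Set Metric Function

namespace Literature.MeasureTheory.Group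

open Literature.Analysis.Calculus

variable {𝔸 : Type*} [NormedRing 𝔸] [NormedAlgebra ℚ 𝔸] [NormedAlgebra ℝ 𝔸] [CompleteSpace 𝔸]
  [FiniteDimensional ℝ 𝔸]
variable {K : Type*} [Group K] [TopologicalSpace K] [CompactSpace K]

omit [NormedAlgebra ℚ 𝔸] [NormedAlgebra ℝ 𝔸] [CompleteSpace 𝔸] [FiniteDimensional ℝ 𝔸]
  [Group K] in
/-- The inverse of a continuous injection from a compact space is continuous on the range.
[folklore] -/
theorem continuousOn_invFun_range {ρ : K → 𝔸} (hρc : Continuous ρ) (hρi : Injective ρ)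
    [Nonempty K] : ContinuousOn (invFun ρ) (range ρ) := by
  rw [continuousOn_iff_isClosed]
  intro C hC
  refine ⟨ρ '' C, (hC.isCompact.image hρc).isClosed, ?_⟩
  ext y
  simp only [mem_inter_iff, mem_preimage, mem_image, mem_range]
  constructor
  · rintro ⟨hy, k, rfl⟩
    exact ⟨⟨k, by rwa [leftInverse_invFun hρi k] at hy, rfl⟩, k, rfl⟩
  · rintro ⟨⟨k, hk, rfl⟩, -⟩
    exact ⟨by rwa [leftInverse_invFun hρi k], k, rfl⟩

omit [CompleteSpace 𝔸] [FiniteDimensional ℝ 𝔸] [TopologicalSpace K] [CompactSpace K] in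
/-- The Lie algebra of the closed linear group `ρ(K)` as a real subspace:
`{X | exp(tX) ∈ ρ(K) ∀ t}` (von Neumann 1929: closed under sums). [cite: vonNeumann1929, §3] -/
theorem exists_lieSubmodule_range (ρ : K →* 𝔸) (hH : IsClosed (range ρ)) [CompleteSpace 𝔸] :
    ∃ 𝔥 : Submodule ℝ 𝔸, ∀ X : 𝔸, X ∈ 𝔥 ↔ ∀ t : ℝ, exp (t • X) ∈ range ρ := by
  have h1 : (1 : 𝔸) ∈ range ρ := ⟨1, map_one ρ⟩
  have hmul : ∀ a ∈ range ρ, ∀ b ∈ range ρ, a * b ∈ range ρ := by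
    rintro _ ⟨a, rfl⟩ _ ⟨b, rfl⟩; exact ⟨a * b, map_mul ρ a b⟩
  have hinv : ∀ a ∈ range ρ, ∃ b ∈ range ρ, b * a = 1 := by
    rintro _ ⟨a, rfl⟩; exact ⟨ρ a⁻¹, ⟨a⁻¹, rfl⟩, by rw [← map_mul, inv_mul_cancel, map_one]⟩
  refine ⟨{ carrier := {X | ∀ t : ℝ, exp (t • X) ∈ range ρ}
            add_mem' := fun hX hY t => exp_smul_add_mem hH h1 hmul hinv hX hY t
            zero_mem' := fun t => by simpa using h1
            smul_mem' := fun c X hX t => by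
              show exp (t • c • X) ∈ range ρ
              rw [smul_smul]; exact hX _ }, fun X => Iff.rfl⟩

/-- **The invariant tube of a compact linear group.** For a continuous injective multiplicative
`ρ : K →* 𝔸` from a compact group into a finite-dimensional real Banach algebra there are: an open
`T ⊆ 𝔸`, a compact `Ω ⊆ T` with `1 ∈ interior Ω`, maps `q : 𝔸 → 𝔸`, `g : 𝔸 → ℝ` real-analytic on
`T` and `qK : 𝔸 → K` continuous on `T`, such that `Ω = {M ∈ T : 0 ≤ g M}`, `q 1 = 1`,
`ρ (qK M) = q M` on `T`, and for every `k : K`: left multiplication by `ρ k` preserves `T` and `Ω`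
(`(ρ k * ·) ⁻¹' Ω = Ω`) and `qK (ρ k * M) = k * qK M` on `T` (tubular neighbourhood `H · (1 + 𝔨_r)`
of the embedded submanifold `H = ρ(K)`, Hall Cor. 3.45, cut off at `Σᵢ eᵢ(a M)² ≤ ρ₀²` in Euclidean
coordinates `eᵢ` of the normal part `a`). [cite: Hall2015, Theorem 3.42 and Corollary 3.45] -/
theorem exists_invariantTube (ρ : K →* 𝔸) (hρc : Continuous ρ) (hρi : Injective ρ) :
    ∃ (T Ω : Set 𝔸) (q : 𝔸 → 𝔸) (g : 𝔸 → ℝ) (qK : 𝔸 → K),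
      IsOpen T ∧ Ω ⊆ T ∧ IsCompact Ω ∧ (1 : 𝔸) ∈ interior Ω ∧ Ω = {M ∈ T | 0 ≤ g M} ∧
      AnalyticOnNhd ℝ q T ∧ AnalyticOnNhd ℝ g T ∧ ContinuousOn qK T ∧ q 1 = 1 ∧
      (∀ M ∈ T, ρ (qK M) = q M) ∧
      (∀ k : K, ∀ M ∈ T, ρ k * M ∈ T ∧ qK (ρ k * M) = k * qK M) ∧
      (∀ k : K, (fun M => ρ k * M) ⁻¹' Ω = Ω) := by
  classical
  set H : Set 𝔸 := range ρ with hHdef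
  have hH : IsClosed H := (isCompact_range hρc).isClosed
  have h1 : (1 : 𝔸) ∈ H := ⟨1, map_one ρ⟩
  have hmul : ∀ a ∈ H, ∀ b ∈ H, a * b ∈ H := by
    rintro _ ⟨a, rfl⟩ _ ⟨b, rfl⟩; exact ⟨a * b, map_mul ρ a b⟩
  have hinv : ∀ a ∈ H, ∃ b ∈ H, b * a = 1 := by
    rintro _ ⟨a, rfl⟩; exact ⟨ρ a⁻¹, ⟨a⁻¹, rfl⟩, by rw [← map_mul, inv_mul_cancel, map_one]⟩
  obtain ⟨𝔥, h𝔥⟩ := exists_lieSubmodule_range ρ hH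
  obtain ⟨𝔨, hc⟩ := Submodule.exists_isCompl 𝔥
  obtain ⟨r, hr, -, q, a, hTopen, hqa, hrep, hequiv, hqan, haan⟩ :=
    exists_tubularMaps hH h1 hmul hinv 𝔥 𝔨 h𝔥 hc
  set T : Set 𝔸 := {M : 𝔸 | ∃ h ∈ H, ∃ A ∈ 𝔨, ‖A‖ < r ∧ M = h * (1 + A)} with hTdef
  -- Euclidean coordinates of `𝔸` and the cut-off radius `ρ₀`
  set e : 𝔸 ≃L[ℝ] EuclideanSpace ℝ (Fin (Module.finrank ℝ 𝔸)) := toEuclidean with he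
  set Ce : ℝ := ‖(e.symm : EuclideanSpace ℝ (Fin (Module.finrank ℝ 𝔸)) →L[ℝ] 𝔸)‖ with hCe
  have hCe0 : 0 ≤ Ce := norm_nonneg _
  set ρ₀ : ℝ := r / (2 * (Ce + 1)) with hρ₀
  have hρ₀pos : 0 < ρ₀ := by positivity
  have hCeρ₀ : Ce * ρ₀ < r := by
    rw [hρ₀, mul_div_assoc', div_lt_iff₀ (by positivity)]; nlinarith
  have hnormA : ∀ A : 𝔸, ‖A‖ ≤ Ce * ‖e A‖ := fun A => by
    calc ‖A‖ = ‖(e.symm : _ →L[ℝ] 𝔸) (e A)‖ := by simp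
      _ ≤ Ce * ‖e A‖ := ContinuousLinearMap.le_opNorm _ _
  have hsq : ∀ A : 𝔸, ‖e A‖ ^ 2 = ∑ i, (e A i) ^ 2 := fun A => by
    rw [EuclideanSpace.norm_eq, Real.sq_sqrt (Finset.sum_nonneg fun i _ => by positivity)]
    exact Finset.sum_congr rfl fun i _ => by rw [Real.norm_eq_abs, sq_abs]
  have hsmall : ∀ A : 𝔸, ∑ i, (e A i) ^ 2 ≤ ρ₀ ^ 2 → ‖A‖ < r := fun A hA => by
    rw [← hsq] at hA
    have h1' : ‖e A‖ ≤ ρ₀ := (pow_le_pow_iff_left₀ (norm_nonneg _) hρ₀pos.le two_ne_zero).1 hA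
    calc ‖A‖ ≤ Ce * ‖e A‖ := hnormA A
      _ ≤ Ce * ρ₀ := mul_le_mul_of_nonneg_left h1' hCe0
      _ < r := hCeρ₀
  -- the cut-off function, the compact tube `Ω`, and the lift `qK`
  let g : 𝔸 → ℝ := fun M => ρ₀ ^ 2 - ∑ i, (e (a M) i) ^ 2
  set Ω : Set 𝔸 := {M ∈ T | 0 ≤ g M} with hΩdef
  haveI : Nonempty K := ⟨1⟩
  let qK : 𝔸 → K := fun M => invFun ρ (q M)
  -- `1 ∈ T`, `q 1 = 1`, `a 1 = 0`
  have h0r : ‖(0 : 𝔸)‖ < r := by simpa using hr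
  have h1T : (1 : 𝔸) ∈ T := ⟨1, h1, 0, 𝔨.zero_mem, h0r, by simp⟩
  have hq1 : q 1 = 1 ∧ a 1 = 0 := by
    have := hqa 1 h1 0 𝔨.zero_mem h0r
    simpa using this
  -- membership in `Ω`
  have hΩmem : ∀ M : 𝔸, M ∈ Ω ↔ ∃ k : K, ∃ A ∈ 𝔨, ∑ i, (e A i) ^ 2 ≤ ρ₀ ^ 2 ∧ M = ρ k * (1 + A) := by
    intro M
    constructor
    · rintro ⟨hMT, hgM⟩
      obtain ⟨hqH, haK, -, hMeq⟩ := hrep M hMT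
      obtain ⟨k, hk⟩ := hqH
      refine ⟨k, a M, haK, ?_, by rw [hk]; exact hMeq⟩
      have : 0 ≤ ρ₀ ^ 2 - ∑ i, (e (a M) i) ^ 2 := hgM
      linarith
    · rintro ⟨k, A, hA, hAρ, rfl⟩
      have hAr : ‖A‖ < r := hsmall A hAρ
      have hMT : ρ k * (1 + A) ∈ T := ⟨ρ k, ⟨k, rfl⟩, A, hA, hAr, rfl⟩
      refine ⟨hMT, ?_⟩
      show 0 ≤ ρ₀ ^ 2 - ∑ i, (e (a (ρ k * (1 + A))) i) ^ 2
      rw [(hqa (ρ k) ⟨k, rfl⟩ A hA hAr).2]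
      linarith
  have hΩT : Ω ⊆ T := fun M hM => hM.1
  -- compactness of `Ω`
  have hKA : IsCompact {A : 𝔸 | A ∈ 𝔨 ∧ ∑ i, (e A i) ^ 2 ≤ ρ₀ ^ 2} := by
    refine Metric.isCompact_of_isClosed_isBounded ?_ ?_
    · refine (𝔨.closed_of_finiteDimensional).inter ?_
      have hcont : Continuous fun A : 𝔸 => ∑ i, (e A i) ^ 2 :=
        continuous_finsetSum _ fun i _ =>
          (((EuclideanSpace.proj (𝕜 := ℝ) (ι := Fin (Module.finrank ℝ 𝔸)) i).continuous).comp
            e.continuous).pow 2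
      exact isClosed_le hcont continuous_const
    · refine (Metric.isBounded_closedBall (x := (0 : 𝔸)) (r := r)).subset ?_
      rintro A ⟨-, hA⟩
      rw [mem_closedBall_zero_iff]
      exact (hsmall A hA).le
  have hΩeq : Ω = (fun p : K × 𝔸 => ρ p.1 * (1 + p.2)) '' (univ ×ˢ {A : 𝔸 | A ∈ 𝔨 ∧ ∑ i, (e A i) ^ 2 ≤ ρ₀ ^ 2}) := by
    ext M
    rw [hΩmem]
    simp only [mem_image, mem_prod, mem_univ, true_and, mem_setOf_eq, Prod.exists]
    constructor
    · rintro ⟨k, A, hA, hAρ, rfl⟩; exact ⟨k, A, ⟨hA, hAρ⟩, rfl⟩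
    · rintro ⟨k, A, ⟨hA, hAρ⟩, rfl⟩; exact ⟨k, A, hA, hAρ, rfl⟩
  have hΩcpt : IsCompact Ω := by
    rw [hΩeq]
    exact (isCompact_univ.prod hKA).image (by fun_prop)
  -- analyticity of `g` on `T`
  have hgan : AnalyticOnNhd ℝ g T := by
    have hcoord : ∀ i, AnalyticOnNhd ℝ (fun M => e (a M) i) T := fun i => by
      have hL : AnalyticOnNhd ℝ (fun x : 𝔸 => e x i) univ := fun x _ =>
        ((EuclideanSpace.proj (𝕜 := ℝ) i).analyticAt _).comp (f := fun y : 𝔸 => e y)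
          ((e : 𝔸 →L[ℝ] EuclideanSpace ℝ (Fin (Module.finrank ℝ 𝔸))).analyticAt x)
      exact hL.comp haan (mapsTo_univ _ _)
    show AnalyticOnNhd ℝ (fun M => ρ₀ ^ 2 - ∑ i, (e (a M) i) ^ 2) T
    refine analyticOnNhd_const.sub ?_
    exact Finset.analyticOnNhd_fun_sum _ fun i _ => (hcoord i).pow 2
  -- `1 ∈ interior Ω`
  have hg1 : g 1 = ρ₀ ^ 2 := by
    show ρ₀ ^ 2 - ∑ i, (e (a 1) i) ^ 2 = ρ₀ ^ 2
    rw [hq1.2, map_zero]; simp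
  have h1int : (1 : 𝔸) ∈ interior Ω := by
    rw [mem_interior_iff_mem_nhds]
    have hT1 : T ∈ 𝓝 (1 : 𝔸) := hTopen.mem_nhds h1T
    have hgc : ContinuousAt g 1 := (hgan 1 h1T).continuousAt
    have hpos : ∀ᶠ M in 𝓝 (1 : 𝔸), 0 < g M :=
      hgc.eventually (lt_mem_nhds (by rw [hg1]; positivity))
    filter_upwards [hT1, hpos] with M hMT hgM
    exact ⟨hMT, hgM.le⟩
  -- the lift `qK`
  have hqK : ∀ M ∈ T, ρ (qK M) = q M := fun M hM => invFun_eq (hrep M hM).1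
  have hqKcont : ContinuousOn qK T :=
    (continuousOn_invFun_range hρc hρi).comp hqan.continuousOn fun M hM => (hrep M hM).1
  -- invariance
  have hTinv : ∀ k : K, ∀ M ∈ T, ρ k * M ∈ T ∧ qK (ρ k * M) = k * qK M := by
    intro k M hM
    obtain ⟨hkM, hqkM, -⟩ := hequiv (ρ k) ⟨k, rfl⟩ M hM
    refine ⟨hkM, hρi ?_⟩
    rw [hqK _ hkM, hqkM, map_mul, hqK _ hM]
  have hΩinv : ∀ k : K, (fun M => ρ k * M) ⁻¹' Ω = Ω := by
    intro k
    have key : ∀ (k : K) (M : 𝔸), M ∈ Ω → ρ k * M ∈ Ω := by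
      rintro k M ⟨hMT, hgM⟩
      obtain ⟨hkM, -, hakM⟩ := hequiv (ρ k) ⟨k, rfl⟩ M hMT
      refine ⟨hkM, ?_⟩
      show 0 ≤ ρ₀ ^ 2 - ∑ i, (e (a (ρ k * M)) i) ^ 2
      rw [hakM]; exact hgM
    ext M
    simp only [mem_preimage]
    refine ⟨fun hM => ?_, key k M⟩
    have := key k⁻¹ _ hM
    rwa [← mul_assoc, ← map_mul, inv_mul_cancel, map_one, one_mul] at this
  exact ⟨T, Ω, q, g, qK, hTopen, hΩT, hΩcpt, h1int, rfl, hqan, hgan, hqKcont, hq1.1, hqK,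
    hTinv, hΩinv⟩

end Literature.MeasureTheory.Group

end
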